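import Summits.ABC.IUTFork.Cor312SettingDHVolArch
import Summits.ABC.IUTFork.Cor312VolumesArchLattice
import Summits.ABC.IUTFork.Cor312VolumesPadicLatticeBounds
import Summits.ABC.IUTFork.Cor312StatementStability
import HarnessLib

/-!
# [IUTchIII] Corollary 3.12, statement — "`−|log(Θ)|` is finite" LOCALLY for the real setting with the verbatim
# volumes AND AN HONEST ARCHIMEDEAN PLACE: `HullDefined` at EVERY `(j, v_ℚ)` from bounded nondegenerate Θ-boxes

Record-only file (D-0012) of the abc-iut cell (wave-5 prover seat abc-iut-w5-d163 gen 2; TEAM A row A-0 NAMED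
LEFTOVER (4) «archimedean radial container vs DH convention», sequel of `Cor312SettingDHVolArch`); TAKES NO SIDE
on [IUTchIII] Cor. 3.12. The first clause "`−|log(Θ)| ∈ ℝ`" of [IUTchIII] Cor. 3.12 (kurims
`paper:url-4b091feeb646` p. 174 l. 16) is obtained in the proof's opening paragraph (p. 175 l. 2–4): "one
concludes easily from the [easily verified] compactness of the `^{1,∘}𝒰_{j,v_ℚ}` … that the quantity
`−|log(Θ)|` is finite". abc-iut-c312-5's `Cor312HullDefinedDHVol` proves c312-7's `HullDefined j v_ℚ` for the
setting `Real.settingDHVol` — at `∞` "UNCONDITIONALLY" because there the field-factor index is EMPTY (the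
trivial archimedean container). For `Real.settingDHVolArch` (honest archimedean place: the `2^j·|V(F)_∞|^{j+1}`
copies of `ℂ` of the canonical decomposition of `M_I`, [IUTchIV] Prop. 1.5 (iii)) THIS file proves
`HullDefined j v_ℚ` at EVERY place from the SAME two transparent conditions on the Θ-boxes at that place —
the union over `m` (the (Ind3)-enlargement) of the boxes of the Θ-pilot object is BOUNDED (Dupuy–Hilado
(4.10)) and NONDEGENERATE (no field factor vanishes identically on it):

* at `v_ℚ = ∞` (`hullDefined_settingDHVolArch_inl`, NEW): the bounded union is absorbed by a scaled integral
  structure `r·B_I` of `M_I` (`ArchPresentation.preimage_subset_ballPk_of_isBounded`), which every (Ind1)/(Ind2)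
  generator FIXES (`family_image_ballPk` — [IUTchIV] Step (vii) p. 30 "the indeterminacies (Ind1) and (Ind2) are
  taken into account by the fact that `B_I ⊆ M_I` is preserved by arbitrary automorphisms of the type discussed
  in Proposition 1.5, (iii)"), so the whole indeterminacy orbit of the (Ind3)-region stays inside the bounded
  `e⁻¹(r·B_I)` (c312-7 `sUnion_possibleImages_subset`);
* at `v_ℚ = p` (`hullDefined_settingDHVolArch_inr`): c312-5's lattice mechanism verbatim (`Π_{v⃗} c·I_{v⃗}` absorbs
  the bounded union and is fixed by every generator: `exists_latticeF_of_norm_le`, `family_image_latticePk`,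
  Dupuy–Hilado §4 intro/§4.7/§4.9), re-assembled for the per-frame setting (the generic step is
  `hullDefined_ofFrames_of_stable`, the `Setting.ofFrames` twin of c312-7's `hullDefined_of_stable`).
Also `thetaRegion3_settingDHVolArch`, `image_thetaRegion3_settingDHVolArch_*`, `thetaLocal_ne_top_settingDHVolArch`,
`thetaHull_adm_settingDHVolArch`. [claim: Mochizuki2012, status: disputed] for the quoted sentences;
[cite: DupuyHilado2025, §4 (intro), §4.10]. Deliberately NOT here: the VALUE of the hull volume at `∞`
(`(j+1)·log π` for boxes exhausting `π^{j+1}·B_I`: L5-t7 `ArchimedeanPacketHull`) and at good primes, `ThetaFinite`,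
`BridgeHyps` (sequel, after c312-5's `Cor312ThetaFiniteDHVol`/`Cor312BridgeHypsDHVol`), any judgement.
-/

noncomputable section

open Set Function NumberField IsDedekindDomain Bornology
open scoped Pointwise

namespace Summit.ABC

namespace IUTFork

/-! ## 0. The `Setting.ofFrames` twin of c312-7's stability criterion -/

namespace Cor312

namespace Setting

open Thm311 Literature.IUT.LogThetaLattice

variable {T : ThetaIndex} {S : Situation T}
variable (n : ℤ) {HT : Type} {LogLink : HT → HT → Type} {IsFull : ∀ {s t : HT}, LogLink s t → Prop}
  (lat : LGPGaussianLogThetaLattice LogLink IsFull)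
  {Frd : Type} {IsoF : Frd → Frd → Type} {Ob : Frd → Type} {realify : Frd → Frd} {Strip : Type}
  {IsoS : Strip → Strip → Type} {M : ∀ v : T.V, v ∈ T.Vbad → Type} [∀ v h, Monoid (M v h)]
  (sig : GlobalLGPFrobenioidSignature T.lstar T.V (· ∈ T.Vbad) Frd IsoF Ob realify Strip IsoS M)
  (split : SplittingMonoids M) {ObΔ : Type} {N : ∀ v : T.V, v ∈ T.Vbad → Type} [∀ v h, Monoid (N v h)]
  (qData : QPilotData ObΔ N) (R : RealFrames S (Ob sig.Clgp) ObΔ)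
  (hq : ∀ j vQ i, R.qCentre (qPilotObject qData) j vQ i ≠ 0)
  (hadm : ∀ j vQ (H : Set (∀ i, R.K j vQ i)), Literature.IUT.LogVolume.IsHullSet (R.K j vQ) H →
    (S.D n).Adm j vQ (R.e j vQ ⁻¹' H))
  (hfin : ∀ j : T.Label, (Function.support fun vQ => (S.D n).logvol j vQ
    (R.e j vQ ⁻¹' Literature.IUT.LogVolume.hullSet (R.K j vQ) (R.qCentre (qPilotObject qData) j vQ))).Finite)

/-- **`HullDefined` from an (Ind1)/(Ind2)-STABLE set, for the per-frame assembler** (the `Setting.ofFrames` twin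
of c312-7's `hullDefined_of_stable`): if `W` is mapped onto itself by every (Ind1)- and (Ind2)-family, contains
the (Ind3)-region, its image under `e` is bounded for the frame, and the image of the (Ind3)-region has a hull
for the frame (with `HasHull` monotone), then `HullDefined j v_ℚ`. [folklore] -/
theorem hullDefined_ofFrames_of_stable (j : T.Label) (vQ : T.VQ) (W : Set (S.L.Packet j vQ))
    (hW : ∀ Φ ∈ S.L.Ind1Family ∪ S.L.Ind2Family, Φ j vQ '' W = W)
    (h3 : (ofFrames n lat sig split qData R hq hadm hfin).thetaRegion3 j vQ ⊆ W)
    (hb : (R.frameK j vQ).IsBounded (R.e j vQ '' W))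
    (hnd : (R.frameK j vQ).HasHull
      (R.e j vQ '' (ofFrames n lat sig split qData R hq hadm hfin).thetaRegion3 j vQ))
    (hmono : ∀ U U' : Set (∀ i, R.K j vQ i), U ⊆ U' → (R.frameK j vQ).HasHull U → (R.frameK j vQ).HasHull U') :
    (ofFrames n lat sig split qData R hq hadm hfin).HullDefined j vQ := by
  rw [ofFrames_hullDefined_iff]
  set P := ofFrames n lat sig split qData R hq hadm hfin
  exact ⟨(R.frameK j vQ).bounded_mono _ _ (Set.image_mono (P.sUnion_possibleImages_subset hW h3)) hb,
    hmono _ _ (Set.image_mono (P.thetaRegion3_subset_sUnion j vQ)) hnd⟩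

end Setting

end Cor312

namespace Thm311

namespace Real

open Cor312 Cor312Vol Literature.IUT.LogThetaLattice Literature.IUT.LogVolume

variable {F : Type} [Field F] [NumberField F] (X : PilotData F) {logv : PadicLogs F} (hlog : LogvAnalytic logv)
  (hc : ∀ w : InfinitePlace F, w.IsComplex)

section Setting

variable (M : Type) [Field M] [NumberField M]
  (archPk : ∀ (j : (thetaIndex X).Label) (vQ : (thetaIndex X).VQ), Set ((logShellsDH X logv).Packet j vQ))
  (archSub : ∀ (j : (thetaIndex X).Label) (v : (thetaIndex X).V),
    Set ((logShellsDH X logv).Packet j ((thetaIndex X).over v)))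
  (Ψ : ℤ → ∀ v : (thetaIndex X).V, v ∈ (thetaIndex X).Vbad → Set ((logShellsDH X logv).StarPacket v))
  (act : ℤ → ∀ v : (thetaIndex X).V, v ∈ (thetaIndex X).Vbad →
    (logShellsDH X logv).StarPacket v → Module.End ℚ ((logShellsDH X logv).StarPacket v))
  (Mmod : ℤ → ∀ j : (thetaIndex X).LabelStar, Set ((logShellsDH X logv).GlobalPacket j.1))
  (region : ℤ → ∀ j : (thetaIndex X).LabelStar, FinDivisor M → ∀ vQ : (thetaIndex X).VQ,
    Set ((logShellsDH X logv).Packet j.1 vQ))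
  (n : ℤ) {HT : Type} {LogLink : HT → HT → Type} {IsFull : ∀ {s t : HT}, LogLink s t → Prop}
  (lat : LGPGaussianLogThetaLattice LogLink IsFull)
  {Frd : Type} {IsoF : Frd → Frd → Type} {Ob : Frd → Type} {realify : Frd → Frd} {Strip : Type}
  {IsoS : Strip → Strip → Type} {Mv : ∀ v : (thetaIndex X).V, v ∈ (thetaIndex X).Vbad → Type}
  [∀ v h, Monoid (Mv v h)]
  (sig : GlobalLGPFrobenioidSignature (thetaIndex X).lstar (thetaIndex X).V (· ∈ (thetaIndex X).Vbad)
    Frd IsoF Ob realify Strip IsoS Mv)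
  (split : SplittingMonoids Mv) {ObΔ : Type} {N : ∀ v : (thetaIndex X).V, v ∈ (thetaIndex X).Vbad → Type}
  [∀ v h, Monoid (N v h)] (qData : QPilotData ObΔ N)
  (thetaBox : ℤ → Ob sig.Clgp → ∀ (j : (thetaIndex X).Label) (vQ : (thetaIndex X).VQ),
    Set (∀ s : factorIdxDHArch X hlog j vQ, factorFieldDHArch X hlog j vQ s))
  (qCentre : ObΔ → ∀ (j : (thetaIndex X).Label) (vQ : (thetaIndex X).VQ),
    ∀ s : factorIdxDHArch X hlog j vQ, factorFieldDHArch X hlog j vQ s)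
  (hq : ∀ j vQ s, qCentre (qPilotObject qData) j vQ s ≠ 0)
  (hfin : ∀ j : (thetaIndex X).Label, (Function.support fun vQ =>
    ((situationDHVolArch X hlog hc M archPk archSub Ψ act Mmod region).D n).logvol j vQ
      (factorMapDHArch X hlog hc j vQ ⁻¹' hullSet (factorFieldDHArch X hlog j vQ)
        (qCentre (qPilotObject qData) j vQ))).Finite)

/-! ## 1. The (Ind3)-region and its image under the field-factor comparison -/

/-- The (Ind3)-enlarged Θ-region of `settingDHVolArch` at `(j, v_ℚ)` IS the preimage under the field-factor comparison
of the union over `m` of the Θ-boxes of the Θ-pilot object. [folklore] -/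
theorem thetaRegion3_settingDHVolArch (j : (thetaIndex X).Label) (vQ : (thetaIndex X).VQ) :
    (settingDHVolArch X hlog hc M archPk archSub Ψ act Mmod region n lat sig split qData thetaBox qCentre hq
      hfin).thetaRegion3 j vQ =
      factorMapDHArch X hlog hc j vQ ⁻¹' ⋃ m : ℤ, thetaBox m (thetaPilotObject sig split) j vQ := by
  rw [Set.preimage_iUnion]
  rfl

/-- At `∞` the field-factor comparison IS `Φ₀ ∘ e` (`ArchPresentation.factorCoords`). [folklore] -/
theorem factorMapDHArch_inl (j : (thetaIndex X).Label) :
    factorMapDHArch X hlog hc j (.inl ()) = (archPresentationDH X logv hc).factorCoords j :=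
  rfl

/-- At a prime the field-factor comparison IS c312-5's (`factorCoords ∘ e` of the `p`-adic presentation).
[folklore] -/
theorem factorMapDHArch_inr (j : (thetaIndex X).Label) (pp : Nat.Primes) :
    factorMapDHArch X hlog hc j (.inr pp) = fun x =>
      haveI : Fact (pp : ℕ).Prime := ⟨pp.2⟩
      (presAt X hlog pp).factorCoords j ((presAt X hlog pp).comparison j x) :=
  rfl

/-- The field-factor comparison is ONTO at every place. [folklore] -/
theorem factorMapDHArch_surjective (j : (thetaIndex X).Label) :
    ∀ vQ : (thetaIndex X).VQ, Function.Surjective (factorMapDHArch X hlog hc j vQ)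
  | .inl u => by
    cases u
    rw [factorMapDHArch_inl]
    exact (archPresentationDH X logv hc).factorCoords_surjective j
  | .inr pp => by
    haveI : Fact (pp : ℕ).Prime := ⟨pp.2⟩
    rw [factorMapDHArch_inr]
    exact ((presAt X hlog pp).factorCoords_surjective j).comp ((presAt X hlog pp).comparison_surjective j)

/-- The image of the (Ind3)-region under the field-factor comparison IS the union of the Θ-boxes. [folklore] -/
theorem image_thetaRegion3_settingDHVolArch (j : (thetaIndex X).Label) (vQ : (thetaIndex X).VQ) :
    factorMapDHArch X hlog hc j vQ ''
        (settingDHVolArch X hlog hc M archPk archSub Ψ act Mmod region n lat sig split qData thetaBox qCentre hq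
          hfin).thetaRegion3 j vQ =
      ⋃ m : ℤ, thetaBox m (thetaPilotObject sig split) j vQ := by
  rw [thetaRegion3_settingDHVolArch]
  exact Set.image_preimage_eq _ (factorMapDHArch_surjective X hlog hc j vQ)

/-! ## 2. The archimedean place: `HullDefined` from BOUNDED and NONDEGENERATE Θ-boxes -/

/-- **`HullDefined` at `v_ℚ = ∞` from two conditions on the Θ-boxes**: if the union over `m` of the Θ-boxes of
the Θ-pilot object at `(j, ∞)` is BOUNDED and NONDEGENERATE in `⊕_{(w,ε)} ℂ`, then the union of ALL possible
images of the Θ-pilot object at `(j, ∞)` is relatively compact and admits its holomorphic hull. PROOF: the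
bounded union is absorbed by a scaled integral structure `r·B_I`, every (Ind1)/(Ind2) generator fixes
`e⁻¹(r·B_I)` (`ArchPresentation.family_image_ballPk`; [IUTchIV] Step (vii) p. 30), and `(Φ₀ ∘ e)(e⁻¹(r·B_I))` is
the bounded polydisc of radius `r`. [claim: Mochizuki2012, status: disputed] -/
theorem hullDefined_settingDHVolArch_inl (j : (thetaIndex X).Label)
    (hbdd : Bornology.IsBounded (⋃ m : ℤ, thetaBox m (thetaPilotObject sig split) j (.inl ())))
    (hnd : IsNondegenerate (factorFieldDHArch X hlog j (.inl ()))
      (⋃ m : ℤ, thetaBox m (thetaPilotObject sig split) j (.inl ()))) :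
    (settingDHVolArch X hlog hc M archPk archSub Ψ act Mmod region n lat sig split qData thetaBox qCentre hq
      hfin).HullDefined j (.inl ()) := by
  set A := archPresentationDH X logv hc with hA
  -- the bounded union of boxes is absorbed by `ballPk r`
  obtain ⟨r, hr, hsub⟩ := A.preimage_subset_ballPk_of_isBounded j hbdd
  refine Setting.hullDefined_ofFrames_of_stable n lat sig split qData
    (realFramesDHArch X hlog hc M archPk archSub Ψ act Mmod region thetaBox qCentre) hq
    (hadm_DHArch X hlog hc M archPk archSub Ψ act Mmod region n) hfin j (.inl ()) (A.ballPk j r)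
    (fun Φ hΦ => A.family_image_ballPk hΦ j r) ?_ ?_ ?_ ?_
  · -- the (Ind3)-region lies in `W = ballPk r`
    show (settingDHVolArch X hlog hc M archPk archSub Ψ act Mmod region n lat sig split qData thetaBox qCentre hq
      hfin).thetaRegion3 j (.inl ()) ⊆ A.ballPk j r
    rw [thetaRegion3_settingDHVolArch]
    exact hsub
  · -- `(Φ₀ ∘ e)(W)` is bounded
    exact A.isBounded_factorCoords_image_ballPk j hr.le
  · -- the image of the (Ind3)-region is the union of the boxes, nondegenerate by hypothesis
    show IsNondegenerate (factorFieldDHArch X hlog j (.inl ())) (factorMapDHArch X hlog hc j (.inl ()) ''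
      (settingDHVolArch X hlog hc M archPk archSub Ψ act Mmod region n lat sig split qData thetaBox qCentre hq
        hfin).thetaRegion3 j (.inl ()))
    rw [image_thetaRegion3_settingDHVolArch]
    exact hnd
  · exact fun U U' h hU => Setting.isNondegenerate_mono h hU

/-! ## 3. A prime: `HullDefined` from BOUNDED and NONDEGENERATE Θ-boxes (c312-5's lattice mechanism) -/

/-- **`HullDefined` at `v_ℚ = p` from two conditions on the Θ-boxes** — for the per-frame setting
`settingDHVolArch` exactly as for c312-5's `settingDHVol` (`Cor312HullDefinedDHVol`): the bounded union of boxes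
is absorbed by a log-shell lattice `Π_{v⃗} c·I_{v⃗}` (`exists_latticeF_of_norm_le`), which every (Ind1)/(Ind2)
generator fixes (`family_image_latticePk`; Dupuy–Hilado §4), and the lattice is bounded.
[claim: Mochizuki2012, status: disputed] -/
theorem hullDefined_settingDHVolArch_inr (j : (thetaIndex X).Label) (pp : Nat.Primes)
    (hbdd : Bornology.IsBounded (⋃ m : ℤ, thetaBox m (thetaPilotObject sig split) j (.inr pp)))
    (hnd : IsNondegenerate (factorFieldDHArch X hlog j (.inr pp))
      (⋃ m : ℤ, thetaBox m (thetaPilotObject sig split) j (.inr pp))) :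
    (settingDHVolArch X hlog hc M archPk archSub Ψ act Mmod region n lat sig split qData thetaBox qCentre hq
      hfin).HullDefined j (.inr pp) := by
  haveI : Fact (pp : ℕ).Prime := ⟨pp.2⟩
  obtain ⟨R, hR⟩ := isBounded_iff_forall_norm_le.1 hbdd
  obtain ⟨c, -, hcR⟩ := (presAt X hlog pp).exists_latticeF_of_norm_le (j := j) R
  have hsub : (⋃ m : ℤ, thetaBox m (thetaPilotObject sig split) j (.inr pp)) ⊆
      (presAt X hlog pp).latticeF j c :=
    fun z hz => hcR z fun s => (norm_le_pi_norm z s).trans (hR z hz)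
  refine Setting.hullDefined_ofFrames_of_stable n lat sig split qData
    (realFramesDHArch X hlog hc M archPk archSub Ψ act Mmod region thetaBox qCentre) hq
    (hadm_DHArch X hlog hc M archPk archSub Ψ act Mmod region n) hfin j (.inr pp) ((presAt X hlog pp).latticePk j c)
    (fun Φ hΦ => (presAt X hlog pp).family_image_latticePk hΦ j c) ?_ ?_ ?_ ?_
  · -- the (Ind3)-region lies in `W`
    intro x hx
    change x ∈ (settingDHVolArch X hlog hc M archPk archSub Ψ act Mmod region n lat sig split qData thetaBox qCentre
      hq hfin).thetaRegion3 j (.inr pp) at hx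
    rw [thetaRegion3_settingDHVolArch] at hx
    have h2 := hsub hx
    rw [← (presAt X hlog pp).preimage_latticeF_comparison c]
    exact h2
  · -- `e '' W = latticeF c` is bounded
    obtain ⟨R', hR'0, hR'⟩ := (presAt X hlog pp).exists_norm_le_of_mem_latticeF (j := j) c
    have himg : factorMapDHArch X hlog hc j (.inr pp) '' (presAt X hlog pp).latticePk j c =
        (presAt X hlog pp).latticeF j c :=
      (presAt X hlog pp).image_latticePk c
    show Bornology.IsBounded (factorMapDHArch X hlog hc j (.inr pp) '' (presAt X hlog pp).latticePk j c)
    rw [himg]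
    exact isBounded_iff_forall_norm_le.2 ⟨R', fun z hz => (pi_norm_le_iff_of_nonneg hR'0).2 (hR' z hz)⟩
  · show IsNondegenerate (factorFieldDHArch X hlog j (.inr pp)) (factorMapDHArch X hlog hc j (.inr pp) ''
      (settingDHVolArch X hlog hc M archPk archSub Ψ act Mmod region n lat sig split qData thetaBox qCentre hq
        hfin).thetaRegion3 j (.inr pp))
    rw [image_thetaRegion3_settingDHVolArch]
    exact hnd
  · exact fun U U' h hU => Setting.isNondegenerate_mono h hU

/-! ## 4. Consequences: `HullDefined` everywhere, `thetaLocal ≠ ⊤`, the hull is admissible -/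

/-- **`HullDefined` at every `(j, v_ℚ)`** from bounded nondegenerate Θ-boxes AT EVERY PLACE (primes AND `∞`).
[claim: Mochizuki2012, status: disputed] -/
theorem hullDefined_settingDHVolArch (j : (thetaIndex X).Label)
    (hbdd : ∀ vQ : (thetaIndex X).VQ,
      Bornology.IsBounded (⋃ m : ℤ, thetaBox m (thetaPilotObject sig split) j vQ))
    (hnd : ∀ vQ : (thetaIndex X).VQ, IsNondegenerate (factorFieldDHArch X hlog j vQ)
      (⋃ m : ℤ, thetaBox m (thetaPilotObject sig split) j vQ)) :
    ∀ vQ : (thetaIndex X).VQ,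
      (settingDHVolArch X hlog hc M archPk archSub Ψ act Mmod region n lat sig split qData thetaBox qCentre hq
        hfin).HullDefined j vQ
  | .inl u => by
    cases u
    exact hullDefined_settingDHVolArch_inl X hlog hc M archPk archSub Ψ act Mmod region n lat sig split qData
      thetaBox qCentre hq hfin j (hbdd _) (hnd _)
  | .inr pp => hullDefined_settingDHVolArch_inr X hlog hc M archPk archSub Ψ act Mmod region n lat sig split qData
      thetaBox qCentre hq hfin j pp (hbdd _) (hnd _)

/-- **The local Θ-volume is a real number at every `(j, v_ℚ)`** (not `+∞`). [claim: Mochizuki2012, status: disputed] -/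
theorem thetaLocal_ne_top_settingDHVolArch (j : (thetaIndex X).Label)
    (hbdd : ∀ vQ : (thetaIndex X).VQ,
      Bornology.IsBounded (⋃ m : ℤ, thetaBox m (thetaPilotObject sig split) j vQ))
    (hnd : ∀ vQ : (thetaIndex X).VQ, IsNondegenerate (factorFieldDHArch X hlog j vQ)
      (⋃ m : ℤ, thetaBox m (thetaPilotObject sig split) j vQ)) (vQ : (thetaIndex X).VQ) :
    (settingDHVolArch X hlog hc M archPk archSub Ψ act Mmod region n lat sig split qData thetaBox qCentre hq
      hfin).thetaLocal j vQ ≠ ⊤ := by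
  unfold Setting.thetaLocal
  rw [if_pos (hullDefined_settingDHVolArch X hlog hc M archPk archSub Ψ act Mmod region n lat sig split qData
    thetaBox qCentre hq hfin j hbdd hnd vQ)]
  exact WithTop.coe_ne_top

/-- The hull `^{n,∘}𝒰_{j,v_ℚ}` of the union of the possible images is then an ADMISSIBLE region of the verbatim
container, archimedean place included (c312-7 `thetaHull_adm`). [claim: Mochizuki2012, status: disputed] -/
theorem thetaHull_adm_settingDHVolArch (j : (thetaIndex X).Label)
    (hbdd : ∀ vQ : (thetaIndex X).VQ,
      Bornology.IsBounded (⋃ m : ℤ, thetaBox m (thetaPilotObject sig split) j vQ))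
    (hnd : ∀ vQ : (thetaIndex X).VQ, IsNondegenerate (factorFieldDHArch X hlog j vQ)
      (⋃ m : ℤ, thetaBox m (thetaPilotObject sig split) j vQ)) (vQ : (thetaIndex X).VQ) :
    ((situationDHVolArch X hlog hc M archPk archSub Ψ act Mmod region).D n).Adm j vQ
      ((settingDHVolArch X hlog hc M archPk archSub Ψ act Mmod region n lat sig split qData thetaBox qCentre hq
        hfin).thetaHull j vQ) :=
  (settingDHVolArch X hlog hc M archPk archSub Ψ act Mmod region n lat sig split qData thetaBox qCentre hq
    hfin).thetaHull_adm (hullDefined_settingDHVolArch X hlog hc M archPk archSub Ψ act Mmod region n lat sig split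
      qData thetaBox qCentre hq hfin j hbdd hnd vQ)

end Setting

end Real

end Thm311

end IUTFork

end Summit.ABC

end
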